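import Summits.KontsevichZagierPeriods.KontsevichZagierPeriods.Theorems.RootDecompQuadraticDescentPair18HomotopyP22

/-! # `RootDecompQuadraticDescentPair18HomotopyP23` — part 23/31 of the mechanical ≤400-line split of `Pair18Homotopy_v14_noguard.lean` (sha256 72e9c8442b4af820…)
Source: decomp-kz lens-6 g9 `Pair18Homotopy.lean` v14 (HOME/decomp-kz-lens-6/g9/, sha256 3dda3232…; critic g4-48/g4-53/g4-56/g5 CLEARED; census pair #18 of crux stmt-KontsevichZagierPeriods-28994: homotopy cells, duplications, inversions, Euler–Landen, arc/angle regions; terminal `pair18_g8strips_of_grid : hEuler → hGrid → hAng4 → (g8 form of #18)`); `#guard_msgs … #print axioms` pins removed for landing.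
Split by census-1 g9 `gen/splitlean.py`: scopes re-opened with their `open`/`variable`/`set_option` context; mathematics and declaration order unchanged. -/

set_option linter.unusedSimpArgs false
noncomputable section
open _root_.Set MvPolynomial
namespace Summit.KontsevichZagierPeriods.RootDecompQuadraticDescent.Pair18Homotopy
open Literature.NumberTheory.Transcendental
open Literature.NumberTheory.Transcendental.KZ (RFun cube)
open Summit.KontsevichZagierPeriods.RootDecompQuadraticDescent.DarkPairs (rel_reflect_rep rel_double)

open _root_.Set MvPolynomial in
open Literature.NumberTheory.Transcendental in
open Literature.NumberTheory.Transcendental.KZ (RFun cube) in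
open Summit.KontsevichZagierPeriods.RootDecompQuadraticDescent.DarkPairs (rel_reflect_rep rel_double) in
/-- Linearity in the integrand (rule 1b): `T = S + U` pointwise on the square. -/
private theorem rel_lin (T S U : RFun 2) (h : ∀ x ∈ cube 2, T.fn x = S.fn x + U.fn x) :
    KZ.of T.rep - KZ.of S.rep - KZ.of U.rep ∈ KZ.relations :=
  KZ.cubicalLinGens_subset_relations (KZ.mem_cubicalLinGens T.isTameCube_rep S.isTameCube_rep
    U.isTameCube_rep fun x hx => by simpa using h x hx)

open _root_.Set MvPolynomial in
open Literature.NumberTheory.Transcendental in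
open Literature.NumberTheory.Transcendental.KZ (RFun cube) in
open Summit.KontsevichZagierPeriods.RootDecompQuadraticDescent.DarkPairs (rel_reflect_rep rel_double) in
/-- Auxiliary step `cube2` (§0): cube2. [bookkeeping] -/
private theorem cube2 {x : Fin 2 → ℝ} (hx : x ∈ KZ.cube 2) : (0 ≤ x 0 ∧ x 0 ≤ 1) ∧ (0 ≤ x 1 ∧ x 1 ≤ 1) := ⟨hx 0, hx 1⟩

/-! ## §17 THE LAST PENCIL, I: structure of `hElem10`, the `M2` split, and `[M2arc]` in ANGLE–ANGLE form

`hElem10` secretly contains TWO transcendental facts: the ANGLE↔LOG BRIDGE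
`hBridge : 6•[Ax0] ≡ [Th7] + [B17] + 2•[PB7]` (`6·π²/24 = (θ + (π/2−θ))²`, a `ζ(2)`-type evaluation of the
`Li₂(−1)`-box `Ax0` against the `arctan√7`-angle boxes) and the pure angle-world congruence `hAngle`; and
`hAngle` reduces by `invP`/`invM` (§2) and the decided pencils `GmGp_B17`, `Gp_pencil` to a statement about
`M2` and `K := [Shp] + [Shm]` only (`hM2K`).  `M2` splits pointwise into a `d log`-part `M2log`
(`= ½log²2`) and an arctan part `−M2arcN`; and the algebraic change of variables
`(x,t) ↦ (tan γ, tan φ) = ((1+2t)/√Δ, ((4+4t)x−(1+2t))/√Δ)`, `Δ = 7+4t−4t² = 8−(2t−1)²`, puts `[M2arcN]`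
EXACTLY into angle–angle form `16/((1+P'²)(1+Q'²))` (affinely rescaled into the unit square) over an
explicit semialgebraic region `RM` — because `(3+2t)dt/((2+2t)√Δ) = 2·d(arctan((1+2t)/√Δ))` and
`Δ + ((4+4t)x−(1+2t))² = (8+8t)·M2Den`. -/
section Pencil3
open Literature.ModelTheory.ExponentialFields (IsSemialgebraic isSemialgebraic_setOf_eval_le
  isSemialgebraic_setOf_eval_pos isSemialgebraic_setOf_eval_nonneg isSemialgebraic_setOf_eval_eq_zero)

/-- **hElem10 = hAngle − 7•hBridge.** -/
theorem pair18_g8strips_of_bridge_angle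
    (hBridge : 6 • KZ.of Ax0.rep - KZ.of Th7.rep - KZ.of B17.rep - 2 • KZ.of PB7.rep ∈ KZ.relations)
    (hAngle : 2 • (2 • KZ.of Sp.rep + 2 • KZ.of Sm.rep + KZ.of M2.rep) + 4 • KZ.of Th7.rep
      - 16 • KZ.of B17.rep - 8 • KZ.of PB7.rep - KZ.of N7U + 3 • KZ.of Lbox.rep - 3 • KZ.of Lq.rep - KZ.of MT
      ∈ KZ.relations) :
    KZ.of U1.rep - KZ.of U2r.rep + KZ.of SL.rep - 2 • KZ.of K12c.rep + 2 • KZ.of Kh.rep ∈ KZ.relations := by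
  refine pair18_g8strips_of_elem10 ?_
  have e : 6 • KZ.of PB7.rep + 2 • (2 • KZ.of Sp.rep + 2 • KZ.of Sm.rep + KZ.of M2.rep)
      + 11 • KZ.of Th7.rep - 9 • KZ.of B17.rep - 42 • KZ.of Ax0.rep - KZ.of N7U + 3 • KZ.of Lbox.rep
      - 3 • KZ.of Lq.rep - KZ.of MT =
      (2 • (2 • KZ.of Sp.rep + 2 • KZ.of Sm.rep + KZ.of M2.rep) + 4 • KZ.of Th7.rep
      - 16 • KZ.of B17.rep - 8 • KZ.of PB7.rep - KZ.of N7U + 3 • KZ.of Lbox.rep - 3 • KZ.of Lq.rep - KZ.of MT)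
      - 7 • (6 • KZ.of Ax0.rep - KZ.of Th7.rep - KZ.of B17.rep - 2 • KZ.of PB7.rep) := by
    simp only [smul_add, smul_sub, smul_smul]
    abel
  rw [e]
  exact sub_mem hAngle (KZ.relations.nsmul_mem hBridge 7)

/-- **hAngle ⟸ hM2K** by the inversion relations `invP`, `invM` (§2) and the two decided pencils. -/
theorem angle_of_M2K
    (hM2K : 2 • KZ.of M2.rep - 4 • KZ.of Shp.rep - 4 • KZ.of Shm.rep + 4 • KZ.of Th7.rep - 8 • KZ.of B17.rep
      - KZ.of N7U + 3 • KZ.of Lbox.rep - 3 • KZ.of Lq.rep - KZ.of MT ∈ KZ.relations) :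
    2 • (2 • KZ.of Sp.rep + 2 • KZ.of Sm.rep + KZ.of M2.rep) + 4 • KZ.of Th7.rep
      - 16 • KZ.of B17.rep - 8 • KZ.of PB7.rep - KZ.of N7U + 3 • KZ.of Lbox.rep - 3 • KZ.of Lq.rep - KZ.of MT
      ∈ KZ.relations := by
  have h := add_mem (add_mem (add_mem (add_mem hM2K (KZ.relations.nsmul_mem invP 4))
    (KZ.relations.nsmul_mem invM 4)) GmGp_B17) (KZ.relations.nsmul_mem Gp_pencil 4)
  convert h using 1
  simp only [smul_add, smul_sub, smul_smul]
  abel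

/-- **#18 ⟸ hBridge ∧ hM2K.** -/
theorem pair18_g8strips_of_bridge_M2K
    (hBridge : 6 • KZ.of Ax0.rep - KZ.of Th7.rep - KZ.of B17.rep - 2 • KZ.of PB7.rep ∈ KZ.relations)
    (hM2K : 2 • KZ.of M2.rep - 4 • KZ.of Shp.rep - 4 • KZ.of Shm.rep + 4 • KZ.of Th7.rep - 8 • KZ.of B17.rep
      - KZ.of N7U + 3 • KZ.of Lbox.rep - 3 • KZ.of Lq.rep - KZ.of MT ∈ KZ.relations) :
    KZ.of U1.rep - KZ.of U2r.rep + KZ.of SL.rep - 2 • KZ.of K12c.rep + 2 • KZ.of Kh.rep ∈ KZ.relations :=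
  pair18_g8strips_of_bridge_angle hBridge (angle_of_M2K hM2K)

/-! ### the `M2` split: `−2(1−x)/D = D'ₓ/((2+2t)D) − (3+2t)/((2+2t)D)`, `D = M2Den` -/

/-- Auxiliary definition `M2LDen` (§17): M2 LDen. [bookkeeping] -/
def M2LDen : MvPolynomial (Fin 2) ℚ := (C 2 + C 2 * X 1) * M2Den
/-- Auxiliary step `M2LDen_pos` (§17): M2 LDen pos. [bookkeeping] -/
theorem M2LDen_pos {x : Fin 2 → ℝ} (hx : x ∈ KZ.cube 2) : 0 < aeval x M2LDen := by
  have h := M2Den_pos hx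
  obtain ⟨h0, h1⟩ := cube2 hx
  rw [M2LDen, map_mul]
  refine mul_pos ?_ h
  simp only [map_add, map_mul, aeval_C, aeval_X, eq_ratCast, Rat.cast_ofNat]
  linarith [h1.1]
/-- `M2log := [□², ((4+4t)x − (1+2t))/((2+2t)·M2Den)] = ∫₀¹ (∂ₓ log M2Den) dt/(2+2t) = ½log²2`. -/
def M2log : RFun 2 := ⟨(C 4 + C 4 * X 1) * X 0 - (C 1 + C 2 * X 1), M2LDen, fun _ hx => (M2LDen_pos hx).ne'⟩
/-- `M2arcN := [□², (3+2t)/((2+2t)·M2Den)]` (the arctan part of `−M2`). -/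
def M2arcN : RFun 2 := ⟨C 3 + C 2 * X 1, M2LDen, fun _ hx => (M2LDen_pos hx).ne'⟩

/-- Auxiliary step `M2_split` (§17): M2 split. [bookkeeping] -/
theorem M2_split : KZ.of M2.rep - KZ.of M2log.rep + KZ.of M2arcN.rep ∈ KZ.relations := by
  have h := rel_lin M2log M2 M2arcN fun x hx => by
    have hD := M2Den_pos hx
    obtain ⟨h0, h1⟩ := cube2 hx
    simp only [M2log, M2, M2arcN, M2LDen, M2Den, RFun.fn, map_add, map_sub, map_mul, map_pow, map_neg,
      aeval_C, aeval_X, map_one, map_ofNat, eq_ratCast, Rat.cast_one, Rat.cast_ofNat, Rat.cast_div,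
      Rat.cast_neg] at hD ⊢
    have h2 : (0:ℝ) < 2 + 2 * x 1 := by linarith [h1.1]
    have h1' : (0:ℝ) < 1 + x 1 := by linarith [h1.1]
    generalize hDv : 1 - (1 + 2 * x 1) * x 0 + (2 + 2 * x 1) * x 0 * x 0 = D at *
    have hD0 : D ≠ 0 := hD.ne'
    field_simp
    ring
  have h' := neg_mem h
  convert h' using 1
  abel

/-! ### the algebraic function `√Δ`, `Δ = 7 + 4t − 4t²` -/

/-- Auxiliary definition `sM` (§17): s M. [bookkeeping] -/
def sM (u : ℝ) : ℝ := Real.sqrt (7 + 4 * u - 4 * u * u)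
/-- Auxiliary step `sM_pos` (§17): s M pos. [bookkeeping] -/
theorem sM_pos {u : ℝ} (hu : 0 < 7 + 4 * u - 4 * u * u) : 0 < sM u := Real.sqrt_pos.2 hu
/-- Auxiliary step `sM_sq` (§17): s M sq. [bookkeeping] -/
theorem sM_sq {u : ℝ} (hu : 0 ≤ 7 + 4 * u - 4 * u * u) : sM u ^ 2 = 7 + 4 * u - 4 * u * u := Real.sq_sqrt hu
/-- Auxiliary step `hasDerivAt_sM` (§17): has Deriv At s M. [bookkeeping] -/
theorem hasDerivAt_sM {u : ℝ} (hu : 0 < 7 + 4 * u - 4 * u * u) : HasDerivAt sM ((2 - 4 * u) / sM u) u := by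
  have hs := sM_pos hu
  have h := ((((hasDerivAt_id' u).const_mul 4).const_add 7).fun_sub
    (((hasDerivAt_id' u).const_mul 4).fun_mul (hasDerivAt_id' u))).sqrt hu.ne'
  refine h.congr_deriv ?_
  have hs' : Real.sqrt (7 + 4 * u - 4 * u * u) ≠ 0 := by unfold sM at hs; exact hs.ne'
  simp only [sM]
  field_simp
  ring
/-- Auxiliary step `hasDerivAt_c0` (§17): has Deriv At c0. [bookkeeping] -/
theorem hasDerivAt_c0 {u : ℝ} (hu : 0 < 7 + 4 * u - 4 * u * u) :
    HasDerivAt (fun v => (1 + 2 * v) / (2 * sM v)) (2 * (3 + 2 * u) / sM u ^ 3) u := by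
  have hs := sM_pos hu
  have hs2 := sM_sq hu.le
  have h := (((hasDerivAt_id' u).const_mul 2).const_add 1).fun_div ((hasDerivAt_sM hu).const_mul 2)
    (by positivity)
  refine h.congr_deriv ?_
  rw [show 2 * (3 + 2 * u) / sM u ^ 3 = (4 * sM u ^ 2 - 2 * (1 + 2 * u) * (2 - 4 * u)) / (4 * sM u ^ 3) by
    rw [hs2]; field_simp; ring]
  field_simp
  ring
/-- Auxiliary step `hasDerivAt_g4` (§17): has Deriv At g4. [bookkeeping] -/
theorem hasDerivAt_g4 {u : ℝ} (hu : 0 < 7 + 4 * u - 4 * u * u) :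
    HasDerivAt (fun v => (4 * sM v)⁻¹) (-(4 * ((2 - 4 * u) / sM u)) / (4 * sM u) ^ 2) u := by
  have hs := sM_pos hu
  exact ((hasDerivAt_sM hu).const_mul 4).fun_inv (by positivity)

/-- graph of `A + L/√D` (`A, L, D` polynomials, `D > 0`) is semialgebraic:
`{(y − A)²·D = L²} ∩ {(y − A)·L ≥ 0}`. -/
theorem isSemialgebraicFunOn_add_div_sqrt {s : Set (Fin 2 → ℝ)} (hs : IsSemialgebraic ℚ s)
    (A L D : MvPolynomial (Fin 2) ℚ) (hD : ∀ x ∈ s, 0 < aeval x D) :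
    IsSemialgebraicFunOn ℚ s (fun x => aeval x A + aeval x L / Real.sqrt (aeval x D)) := by
  rw [isSemialgebraicFunOn_iff]
  have hq := isSemialgebraic_setOf_eval_eq_zero (k := ℚ) (R := ℝ)
    ((X (Fin.last 2) - rename Fin.castSucc A) ^ 2 * rename Fin.castSucc D - rename Fin.castSucc L ^ 2 :
      MvPolynomial (Fin 3) ℚ)
  have hp := isSemialgebraic_setOf_eval_nonneg (k := ℚ) (R := ℝ)
    ((X (Fin.last 2) - rename Fin.castSucc A) * rename Fin.castSucc L : MvPolynomial (Fin 3) ℚ)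
  convert hs.setOf_init_mem.inter (hq.inter hp) using 1
  have hinit : ∀ z : Fin (2 + 1) → ℝ, (fun i => z (Fin.castSucc i)) = Fin.init z := fun _ => rfl
  ext z
  simp only [mem_setOf_eq, mem_inter_iff, map_sub, map_mul, map_pow, aeval_X, aeval_rename,
    Function.comp_def, hinit, sub_eq_zero]
  constructor
  · rintro ⟨hz, he⟩
    have hDp := hD _ hz
    have hsq : 0 < Real.sqrt (aeval (Fin.init z) D) := Real.sqrt_pos.2 hDp
    have hy : z (Fin.last 2) - aeval (Fin.init z) A = aeval (Fin.init z) L / Real.sqrt (aeval (Fin.init z) D) := by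
      rw [he]; ring
    refine ⟨hz, ?_, ?_⟩
    · rw [hy, div_pow, Real.sq_sqrt hDp.le, div_mul_cancel₀ _ hDp.ne']
    · rw [hy, div_mul_eq_mul_div]; exact div_nonneg (mul_self_nonneg _) hsq.le
  · rintro ⟨hz, he, hnn⟩
    refine ⟨hz, ?_⟩
    have hDp := hD _ hz
    have hsq : 0 < Real.sqrt (aeval (Fin.init z) D) := Real.sqrt_pos.2 hDp
    set y := z (Fin.last 2) with hydef
    set Av := aeval (Fin.init z) A with hAv
    set Lv := aeval (Fin.init z) L with hLv
    set Dv := aeval (Fin.init z) D with hDv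
    have e1 : ((y - Av) * Real.sqrt Dv) ^ 2 = Lv ^ 2 := by
      rw [mul_pow, Real.sq_sqrt hDp.le, he]
    rcases eq_or_eq_neg_of_sq_eq_sq _ _ e1 with h | h
    · have : y - Av = Lv / Real.sqrt Dv := by rw [eq_div_iff hsq.ne']; exact h
      linarith
    · have h1 : (y - Av) * Lv = -((y - Av) * (y - Av) * Real.sqrt Dv) := by
        rw [show Lv = -((y - Av) * Real.sqrt Dv) by linarith [h]]; ring
      have h2 : (y - Av) * (y - Av) * Real.sqrt Dv ≤ 0 := by linarith [hnn]
      have h3 : (y - Av) * (y - Av) ≤ 0 := by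
        by_contra hc
        push Not at hc
        linarith [mul_pos hc hsq]
      have h4 : y - Av = 0 := mul_self_eq_zero.mp (le_antisymm h3 (mul_self_nonneg _))
      have hL : Lv = 0 := by rw [h4, zero_mul] at h; linarith
      rw [hL, zero_div, add_zero]; linarith

/-- Auxiliary step `isSemialgebraic_of_le` (§17): is Semialgebraic of le. [bookkeeping] -/
theorem isSemialgebraic_of_le (p q : MvPolynomial (Fin 2) ℚ) (S : Set (Fin 2 → ℝ))
    (h : ∀ z : Fin 2 → ℝ, aeval z p ≤ aeval z q ↔ z ∈ S) : IsSemialgebraic ℚ S := by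
  have h0 := isSemialgebraic_setOf_eval_le (R := ℝ) p q
  have e : {x : Fin 2 → ℝ | aeval x p ≤ aeval x q} = S := by ext z; exact h z
  rw [e] at h0; exact h0

/-! ### the angle–angle box and the region `RM` -/

/-- Auxiliary definition `AngDen` (§17): Ang Den. [bookkeeping] -/
def AngDen : MvPolynomial (Fin 2) ℚ := (C 1 + C 4 * X 0 * X 0) * (C 1 + (C 4 * X 1 - C 2) * (C 4 * X 1 - C 2))
/-- Auxiliary step `AngDen_pos` (§17): Ang Den pos. [bookkeeping] -/
theorem AngDen_pos (x : Fin 2 → ℝ) : 0 < aeval x AngDen := by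
  simp only [AngDen, map_add, map_sub, map_mul, aeval_C, aeval_X, eq_ratCast, Rat.cast_ofNat, Rat.cast_one]
  nlinarith [mul_self_nonneg (x 0), mul_self_nonneg (4 * x 1 - 2), mul_nonneg (mul_self_nonneg (x 0)) (mul_self_nonneg (4 * x 1 - 2))]
/-- `Ang := [□², 16/((1+4s²)(1+(4w−2)²))]` = `2·dP dQ/((1+P²)(1+Q²))` in `P = 2s`, `Q = 4w − 2`. -/
def Ang : RFun 2 := ⟨C 16, AngDen, fun x _ => (AngDen_pos x).ne'⟩

/-- Auxiliary definition `sRM1` (§17): s RM1. [bookkeeping] -/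
def sRM1 : Set (Fin 2 → ℝ) := {z | 1 ≤ 28 * z 0 * z 0}
/-- Auxiliary definition `sRM2` (§17): s RM2. [bookkeeping] -/
def sRM2 : Set (Fin 2 → ℝ) := {z | 28 * z 0 * z 0 ≤ 9}
/-- Auxiliary definition `sRM3` (§17): s RM3. [bookkeeping] -/
def sRM3 : Set (Fin 2 → ℝ) := {z | 2 - 2 * z 0 ≤ 4 * z 1}
/-- Auxiliary definition `sRM4` (§17): s RM4. [bookkeeping] -/
def sRM4 : Set (Fin 2 → ℝ) := {z | (4 * z 1 - 2) * (4 * z 1 - 2) ≤ 8 * z 0 * z 0 + 1}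
/-- the image region: `1 ≤ 7P² ≤ 9`, `−P ≤ Q`, `Q² ≤ 2P² + 1` in `P = 2s`, `Q = 4w−2`. -/
def RM : Set (Fin 2 → ℝ) := cube 2 ∩ (sRM1 ∩ sRM2 ∩ sRM3 ∩ sRM4)
/-- Auxiliary step `isSemialgebraic_RM` (§17): is Semialgebraic RM. [bookkeeping] -/
theorem isSemialgebraic_RM : IsSemialgebraic ℚ RM := by
  refine KZ.isSemialgebraic_cube.inter (((?_ : IsSemialgebraic ℚ sRM1).inter ?_).inter ?_ |>.inter ?_)
  · exact isSemialgebraic_of_le (C 1) (C 28 * X 0 * X 0) sRM1 fun z => by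
      simp only [sRM1, mem_setOf_eq, map_mul, aeval_C, aeval_X, eq_ratCast, Rat.cast_ofNat, Rat.cast_one]
  · exact isSemialgebraic_of_le (C 28 * X 0 * X 0) (C 9) sRM2 fun z => by
      simp only [sRM2, mem_setOf_eq, map_mul, aeval_C, aeval_X, eq_ratCast, Rat.cast_ofNat, Rat.cast_one]
  · exact isSemialgebraic_of_le (C 2 - C 2 * X 0) (C 4 * X 1) sRM3 fun z => by
      simp only [sRM3, mem_setOf_eq, map_mul, map_sub, aeval_C, aeval_X, eq_ratCast, Rat.cast_ofNat,
        Rat.cast_one]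
  · exact isSemialgebraic_of_le ((C 4 * X 1 - C 2) * (C 4 * X 1 - C 2)) (C 8 * X 0 * X 0 + C 1) sRM4 fun z => by
      simp only [sRM4, mem_setOf_eq, map_mul, map_sub, map_add, aeval_C, aeval_X, eq_ratCast,
        Rat.cast_ofNat, Rat.cast_one]
/-- Auxiliary definition `AngR` (§17): Ang R. [bookkeeping] -/
def AngR : KZ.IntegralRep 2 := Ang.rep.restrict RM isSemialgebraic_RM (fun _ hz => hz.1)

/-- Auxiliary step `M2_facts` (§17): M2 facts. [bookkeeping] -/
theorem M2_facts (z : Fin 2 → ℝ) (hz : z ∈ cube 2) :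
    (0 ≤ z 0 ∧ z 0 ≤ 1) ∧ (0 ≤ z 1 ∧ z 1 ≤ 1) ∧ 0 < 7 + 4 * z 1 - 4 * z 1 * z 1 ∧ 0 < sM (z 1) ∧
      sM (z 1) ^ 2 = 7 + 4 * z 1 - 4 * z 1 * z 1 ∧
      0 < 1 - (1 + 2 * z 1) * z 0 + (2 + 2 * z 1) * z 0 * z 0 ∧
      1 + 2 * z 1 ≤ 2 * sM (z 1) ∧ 3 + 2 * z 1 ≤ 2 * sM (z 1) := by
  obtain ⟨h0, h1⟩ := cube2 hz
  have hΔ : 0 < 7 + 4 * z 1 - 4 * z 1 * z 1 := by nlinarith [mul_nonneg h1.1 (sub_nonneg.2 h1.2)]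
  have hs := sM_pos hΔ
  have hs2 := sM_sq hΔ.le
  have hD := M2Den_pos hz
  simp only [map_add, map_sub, map_mul, map_pow, map_neg, aeval_C, aeval_X, map_one, eq_ratCast, Rat.cast_one,
    Rat.cast_ofNat, Rat.cast_div, Rat.cast_neg, M2Den] at hD
  have h3 : 3 + 2 * z 1 ≤ 2 * sM (z 1) := by
    have h4 : (3 + 2 * z 1) ^ 2 ≤ (2 * sM (z 1)) ^ 2 := by
      rw [mul_pow, hs2]; nlinarith [h1.1, h1.2, mul_nonneg h1.1 (sub_nonneg.2 h1.2)]
    exact (pow_le_pow_iff_left₀ (by linarith) (by linarith) two_ne_zero).mp h4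
  exact ⟨h0, h1, hΔ, hs, hs2, hD, by linarith, h3⟩

end Pencil3
end Summit.KontsevichZagierPeriods.RootDecompQuadraticDescent.Pair18Homotopy
end
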